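import Summits.HubbardSuperconductivity.HubbardSuperconductivity.Theorems.AnisotropyChordTransferFibre3FinXBCert
import Summits.HubbardSuperconductivity.HubbardSuperconductivity.Theorems.AnisotropyChordTransferFibre3FinNumVac
import Summits.HubbardSuperconductivity.HubbardSuperconductivity.Theorems.AnisotropyChordTransferFibre3FinMHoleSound
import Summits.HubbardSuperconductivity.HubbardSuperconductivity.Theorems.AnisotropyChordTransferFibre3GroundUnique
import Summits.HubbardSuperconductivity.HubbardSuperconductivity.Theorems.AnisotropyChordTransferFibre3GroundState

/-!
# Route `AnisotropyChord` / H0 rotor rung: FIN small-`L` EXACT-BLOCK certificate — the λ-cell cover and the row-`N₁` crux per `L`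

The per-`L` packaging of the cell certificate `…Fibre3FinXBCert.xb_cell_sound`: a list of fixed-point points
`(p₀, c₀), (p₁, c₁), …` (cells `[pᵢ, pᵢ₊₁]` with their own constants `cᵢ`) covering the a-priori window `λ₂·D ∈ [0, lamTop L]`
(p1 `forall_ground_of_window_7`), each cell being EITHER vacuous — numerator vacuity (g4 `vacuous_of_num_neg`), `Δ < 0`, or
`Δ > Δ₁` (the `Δ → 1⁻` strip is excluded by hypothesis, see the corner finding) — OR certified by `xbCellOK`.
* `xbCellAny L Δ₁ la lb c`, `cellsAllQ`, `cellsLastQ`, ★ `xbCheck L Δ₁ cells`;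
* `cover_allQ` (the arithmetic cover), ★ `xb_of_check`: for `0 < Δ ≤ Δ₁`, `Δ < 1`, every ground profile has `c·U ≤ N₁` with the
  constant `c` of ITS cell; ★★ `trialGapAbs_of_check`: `TrialGapAbs L Δ c` for any `c` below every cell constant (`Tplus_pos`), and
  ★★ `trialGapAbs_cell_of_check`: `TrialGapAbs L Δ cᵢ` with the constant of the cell of the (unique, `ground_lam2_unique`) ground `λ₂(Δ)`.
Prover seat `hubbard-h0-rotor-p3` g5; helper for piece A = stmt-HubbardSuperconductivity-23918 of rung 19089 (`--supports`, helper
class).  WHAT THIS IS NOT: nothing here proves superconductivity in the Hubbard model (rotor TARGET as worded stays FALSE, g15 verdict);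
the FIN form of ONE hypothesis (the `N₁` row) of ONE conditional reduction.  Tree imports only; no sorry, no new axioms.
-/

set_option linter.dupNamespace false
set_option autoImplicit false

namespace Summit.HubbardSuperconductivity.HubbardSuperconductivity.Theorems.AnisotropyChord.Transfer.Fibre3

namespace FinXB

open scoped BigOperators
open Finset Hole2 FinCell

/-! ## The per-`L` certificate (computable) -/

/-- one cell `[la, lb]` with constant `c`: numerator-vacuous, or `Δ`-vacuous on either side of `(0, Δ₁]`, or certified. -/
def xbCellAny (L : ℕ) (d1 : ℚ) (la lb : ℤ) (c : ℚ) : Bool :=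
  (denCellPos L (cosTab L) la lb && decide ((numIv L la lb).2 < 0) && decide (0 ≤ (G0Iv L la lb).1)) ||
  (groundCellCheck L la lb &&
    (decide ((deltaIv L la lb).2 < 0) || decide (d1 * (D : ℚ) < (((deltaIv L la lb).1 : ℤ) : ℚ)))) ||
  xbCellOK L la lb c

/-- pairwise check of consecutive points, each cell with the constant attached to its left point. -/
def cellsAllQ (ok : ℤ → ℤ → ℚ → Bool) : List (ℤ × ℚ) → Bool
  | [] => true
  | [_] => true
  | a :: b :: rest => ok a.1 b.1 a.2 && cellsAllQ ok (b :: rest)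

/-- the last point. -/
def cellsLastQ : List (ℤ × ℚ) → ℤ
  | [] => 0
  | [a] => a.1
  | _ :: b :: rest => cellsLastQ (b :: rest)

/-- ★ THE PER-`L` ROW-`N₁` CERTIFICATE on `0 < Δ ≤ Δ₁`: points start at `0`, end `≥ lamTop L`, every cell passes `xbCellAny`. -/
def xbCheck (L : ℕ) (d1 : ℚ) (cells : List (ℤ × ℚ)) : Bool :=
  decide ((cells.head?.map Prod.fst) = some 0) && decide (2 ≤ cells.length) && decide (lamTop L ≤ cellsLastQ cells)
    && cellsAllQ (xbCellAny L d1) cells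

/-! ## The cover -/

/-- the arithmetic cover: a point of `[p₀, last]` lies in some checked cell, with that cell's constant in the list. [folklore] -/
theorem cover_allQ (ok : ℤ → ℤ → ℚ → Bool) : ∀ (rest : List (ℤ × ℚ)) (a b : ℤ × ℚ) (x : ℝ),
    cellsAllQ ok (a :: b :: rest) = true → (a.1 : ℝ) ≤ x → x ≤ ((cellsLastQ (a :: b :: rest) : ℤ) : ℝ) →
    ∃ c d : ℤ, ∃ q : ℚ, ok c d q = true ∧ (c : ℝ) ≤ x ∧ x ≤ (d : ℝ) ∧ q ∈ (a :: b :: rest).map Prod.snd := by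
  intro rest
  induction rest with
  | nil =>
    intro a b x hok ha hb
    unfold cellsAllQ at hok
    rw [Bool.and_eq_true] at hok
    exact ⟨a.1, b.1, a.2, hok.1, ha, by simpa [cellsLastQ] using hb, by simp⟩
  | cons r rest ih =>
    intro a b x hok ha hb
    unfold cellsAllQ at hok
    rw [Bool.and_eq_true] at hok
    by_cases hxb : x ≤ (b.1 : ℝ)
    · exact ⟨a.1, b.1, a.2, hok.1, ha, hxb, by simp⟩
    · push Not at hxb
      have hb' : x ≤ ((cellsLastQ (b :: r :: rest) : ℤ) : ℝ) := by simpa [cellsLastQ] using hb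
      obtain ⟨c, d, q, hcd, hc, hd, hq⟩ := ih b r x hok.2 hxb.le hb'
      exact ⟨c, d, q, hcd, hc, hd, by simp only [List.map_cons, List.mem_cons] at hq ⊢; tauto⟩

/-- one cell: for a ground profile at `0 < Δ ≤ Δ₁ < 1` with `λ₂·D` in a cell passing `xbCellAny`, `c·U ≤ N₁`. [folklore] -/
theorem xb_cellAny_sound (L : ℕ) [NeZero L] (hL : 5 ≤ L) {d1 : ℚ} {Δ lam2 : ℝ} (hΔ0 : 0 < Δ) (hΔd : Δ ≤ (d1 : ℝ))
    (hΔ1 : Δ < 1) {f : Tor L → ℝ} (hf : IsGroundTwoMagnon L Δ lam2 f) {la lb : ℤ}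
    (hla : (la : ℝ) ≤ lam2 * ((D : ℤ) : ℝ)) (hlb : lam2 * ((D : ℤ) : ℝ) ≤ (lb : ℝ)) {c : ℚ}
    (hok : xbCellAny L d1 la lb c = true) : (c : ℝ) * Uunit L Δ f ≤ trialGapN1 L Δ f := by
  have hL3 : 3 ≤ L := by omega
  have hD := D_pos
  have hlam : 0 < lam2 := lam2_pos L hL3 hΔ1 hf.1
  have hΔe : Δ = deltaOfLam L lam2 := ground_delta_eq L hL hΔ0.le hΔ1 hf
  unfold xbCellAny at hok
  simp only [Bool.or_eq_true, Bool.and_eq_true, decide_eq_true_eq] at hok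
  rcases hok with (⟨⟨hpos, hnum⟩, hG0⟩ | ⟨hgc, hvac⟩) | hcert
  · exact (vacuous_of_num_neg (L := L) hL3 hlam hla hlb hpos hnum hG0 hΔ0 hΔ1 hΔe).elim
  · exfalso
    have hmd := mem_delta_cell L hL3 hlam hla hlb hgc
    rw [← hΔe] at hmd
    obtain ⟨hlo, hhi⟩ := hmd
    rcases hvac with hneg | hbig
    · have : ((((deltaIv L la lb).2 : ℤ)) : ℝ) < 0 := by exact_mod_cast hneg
      nlinarith
    · have hbig' : (d1 : ℝ) * ((D : ℤ) : ℝ) < ((((deltaIv L la lb).1 : ℤ)) : ℝ) := by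
        have := hbig
        have e : (((D : ℚ)) : ℝ) = ((D : ℤ) : ℝ) := by norm_cast
        rw [← e]; exact_mod_cast this
      nlinarith
  · exact xb_cell_sound hL hΔ0.le hΔ1 hf hla hlb hcert

/-- ★ from the per-`L` certificate: every ground profile at `0 < Δ ≤ Δ₁`, `Δ < 1` satisfies `c·U ≤ N₁` with the constant of its
cell (some entry of the list). [folklore] -/
theorem xb_of_check (L : ℕ) [NeZero L] (hL : 7 ≤ L) {d1 : ℚ} {cells : List (ℤ × ℚ)} (h : xbCheck L d1 cells = true)
    {Δ : ℝ} (hΔ0 : 0 < Δ) (hΔd : Δ ≤ (d1 : ℝ)) (hΔ1 : Δ < 1) :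
    ∀ lam2 : ℝ, ∀ f : Tor L → ℝ, IsGroundTwoMagnon L Δ lam2 f →
      ∃ q ∈ cells.map Prod.snd, (q : ℝ) * Uunit L Δ f ≤ trialGapN1 L Δ f := by
  refine forall_ground_of_window_7 L hL hΔ0.le hΔ1 _ ?_
  intro lam2 f hf hlam0 hlamle
  have hD := D_pos
  unfold xbCheck at h
  simp only [Bool.and_eq_true, decide_eq_true_eq] at h
  obtain ⟨⟨⟨hhead, hlen⟩, htop⟩, hok⟩ := h
  obtain ⟨a, b, rest, hcells⟩ : ∃ a b : ℤ × ℚ, ∃ rest : List (ℤ × ℚ), cells = a :: b :: rest := by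
    match cells, hlen with
    | a :: b :: rest, _ => exact ⟨a, b, rest, rfl⟩
  subst hcells
  have ha0 : a.1 = 0 := by simpa using hhead
  set x : ℝ := lam2 * ((D : ℤ) : ℝ) with hx
  have hx0 : (a.1 : ℝ) ≤ x := by rw [ha0, hx]; push_cast; positivity
  have hxtop : x ≤ ((cellsLastQ (a :: b :: rest) : ℤ) : ℝ) :=
    (lam_mul_D_le_lamTop L (by omega) hlamle).trans (by exact_mod_cast htop)
  obtain ⟨c, d, q, hcell, hcx, hxd, hq⟩ := cover_allQ (xbCellAny L d1) rest a b x hok hx0 hxtop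
  exact ⟨q, hq, xb_cellAny_sound L (by omega) hΔ0 hΔd hΔ1 hf hcx hxd hcell⟩

/-- ★★ THE ROW-`N₁` CRUX AT THIS `L` with a uniform constant: `TrialGapAbs L Δ c` for `0 < Δ ≤ Δ₁`, `Δ < 1` and any `c` below
every cell constant (`U > 0` by `Tplus_pos`). [folklore] -/
theorem trialGapAbs_of_check (L : ℕ) [NeZero L] (hL : 7 ≤ L) {d1 : ℚ} {cells : List (ℤ × ℚ)} (h : xbCheck L d1 cells = true)
    {c : ℚ} (hc : ∀ q ∈ cells.map Prod.snd, c ≤ q) {Δ : ℝ} (hΔ0 : 0 < Δ) (hΔd : Δ ≤ (d1 : ℝ)) (hΔ1 : Δ < 1) :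
    TrialGapAbs L Δ c := by
  intro lam2 f hf
  obtain ⟨q, hq, hle⟩ := xb_of_check L hL h hΔ0 hΔd hΔ1 lam2 f hf
  have hU : 0 < Uunit L Δ f := by
    unfold Uunit
    have hT := Tplus_pos L (by omega) hΔ1 hf
    have hLpos : (0 : ℝ) < L := by exact_mod_cast (show 0 < L by omega)
    positivity
  have hcq : ((c : ℚ) : ℝ) ≤ ((q : ℚ) : ℝ) := by exact_mod_cast hc q hq
  exact (mul_le_mul_of_nonneg_right hcq hU.le).trans hle

/-- ★★ the per-cell form as `TrialGapAbs`: at `0 < Δ ≤ Δ₁`, `Δ < 1`, there is a cell constant `q` (that of the cell of the ground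
`λ₂(Δ)`, unique by `ground_lam2_unique`) with `TrialGapAbs L Δ q`. [folklore] -/
theorem trialGapAbs_cell_of_check (L : ℕ) [NeZero L] (hL : 7 ≤ L) {d1 : ℚ} {cells : List (ℤ × ℚ)}
    (h : xbCheck L d1 cells = true) {Δ : ℝ} (hΔ0 : 0 < Δ) (hΔd : Δ ≤ (d1 : ℝ)) (hΔ1 : Δ < 1) :
    ∃ q ∈ cells.map Prod.snd, TrialGapAbs L Δ q := by
  obtain ⟨lam2, f, hf⟩ := exists_ground L (by omega) Δ
  obtain ⟨q, hq, hle⟩ := xb_of_check L hL h hΔ0 hΔd hΔ1 lam2 f hf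
  refine ⟨q, hq, fun lam2' f' hf' => ?_⟩
  have hl : lam2' = lam2 := ground_lam2_unique L (by omega) hf' hf
  subst hl
  have hff : f' = f := by
    rw [ground_eq_explicit L (by omega) hΔ0.le hΔ1 hf', ground_eq_explicit L (by omega) hΔ0.le hΔ1 hf]
  subst hff
  exact hle

end FinXB

end Summit.HubbardSuperconductivity.HubbardSuperconductivity.Theorems.AnisotropyChord.Transfer.Fibre3
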